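import Literature.NumberTheory.Rogawski1990.XiLocalCharacter
import Literature.NumberTheory.Rogawski1990.GlobalAPacketMembership
import Literature.NumberTheory.Automorphic.TorusCharacterLocalComponentSplit
import Literature.NumberTheory.Automorphic.UnitaryGroupConstantTermSplit
import HarnessLib

/-!
# `ξ_v` at a SPLIT place in the `GL₂(L_w) × GL₁(L_w)` picture: `ξ_v(h) · μ_w(det₀ h) = (η_w ψ_w μ_w)(det h₂) · ψ_w(h₁)` — the block characters
# `(ν₀ ∘ det, ψ_w)` of the split member `i_G(ξ_w ⊗ μ_w ∘ det₀)` (Rogawski 1990, Lemma 4.13.1 (b); §13.3 p. 202)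

Topic `NumberTheory/Rogawski1990`; namespace `Literature.NumberTheory.Rogawski1990`.  THEOREMS ONLY (no definition, no instance, no notation, no named fact, no
`sorry`); kernel lane.  Cell `pub/hodgecm-mathlib`, line «CMCharIdentityTest» (F0P3b desk): the ξ-DICTIONARY half of the van Dijk joint `stub_vanDijkGL` — the
integrand of ★ `UnitaryGroup.integral_mul_cmSplitTransfer` (`ξ_v(h) · μ_w(det (e₂ h.1)) · f̄^P(h)`) against the Levi character of ★ `splitMemberGL`
(`maxParabolicLeviChar L_w 3 ν₀ ψ_w`, `ν₀ = ★ OneDimAutRepH.splitν₀ = η_w ψ_w μ_w`) read on ★ `UnitaryGroup.cmSplitLeviGL h = diag(e₂ h.1, e₁ h.2)`.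
* §1 `piUnits_localDet_eq_det_cmSplitEquivTwo ∕ One` — the `w`-component of `det h.1 ∈ T(L⁺_v)` IS `det (e₂ h.1) ∈ L_wˣ` (`e₂ = cmSplitEquivTwo` = projection to the
  `w`-factor, ★ `GLn.coe_piEquiv_apply`, `RingHom.map_det`).
* §2 **`xiLocalChar_eq_locη_mul_locψ_of_split`** — `ξ_v(h) = η_w(det e₂ h.1) · ψ_w(det e₂ h.1 · det e₁ h.2)` (★ `xiLocalChar_apply_eq` + ★
  `torusLocalComponent_eq_inv_localComponent_of_split` + the definitions ★ `locη w := (bcη.localComponent w)⁻¹`, ★ `locψ`).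
* §3 `det_leviProjection_reindexGL_blockDiagGL_false ∕ _true` (generic two-block lemma, any labelling EQUAL to `[k ≤ i]`) and `…_cmSplitLeviGL_false ∕ _true`
  (`Zelevinsky1980.lastBlockLabel 3`, via ★ `UnitaryGroup.lastBlockLabel_three_eq`).
* §4 **`xiLocalChar_mul_localComponent_eq_maxParabolicLeviChar`** — the dictionary:
  `ξ_v(h) · μ_w(det (e₂ h.1)) = maxParabolicLeviChar L_w 3 (ξ.splitν₀ μ w) (ξ.locψ w) (leviProjection _ _ ⟨cmSplitLeviGL h, _⟩)`.
HONEST LABEL: HC_CM is proved only modulo the printed citations (2 remaining named inputs hLiu418, h413) until rung 0 closes; this file is the local character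
bookkeeping of [Rogawski1990, 4.13.1 (b)] at a split place and discharges none of them.

## References
* [Rogawski1990] J. D. Rogawski, *Automorphic Representations of Unitary Groups in Three Variables* (1990), §4.13 Lemma 4.13.1 (b) p. 64; §12.2 pp. 173–174;
  §13.3 p. 202 (`ξ(h) = η(det₀ h) ψ(det h)`).
* [Zelevinsky1980] A. V. Zelevinsky, *Induced representations of reductive 𝔭-adic groups II*, §3.2.
-/

set_option autoImplicit false

noncomputable section

open NumberField IsDedekindDomain Literature.NumberTheory.GaloisRepresentations Literature.NumberTheory.Automorphic
open Literature.NumberTheory.Automorphic.UnitaryGroup Literature.NumberTheory.Automorphic.Arthur2013.Leaves.TECR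
open Literature.NumberTheory.Automorphic.Zelevinsky1980
open scoped MatrixGroups

namespace Literature.NumberTheory.Rogawski1990

variable (L : Type) [Field L] [NumberField L] [IsCMField L] (v : HeightOneSpectrum (𝓞 ↥(maximalRealSubfield L)))
  (w : PlacesOver L v) (hw : IsCMField.complexConj L • w.1 ≠ w.1)

/-! ## §1 The `w`-component of `det` -/

/-- **`(det h₂)_w = det (e₂ h₂)`**: the `w`-component of the norm-one determinant `det h₂ ∈ T(L⁺_v)` of `h₂ ∈ U(Φ₂)(L⁺_v)` is the determinant of its image
`e₂ h₂ ∈ GL₂(L_w)` under the split-place identification (projection to the `w`-factor). [cite: Rogawski1990, §4.13 p. 64; §12.2 pp. 173–174] -/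
theorem piUnits_localDet_eq_det_cmSplitEquivTwo
    (x : (cmDatum L 2 (Matrix.of fun i j : Fin 2 => if i.val + j.val + 1 = 2 then (1 : L) else 0)).Local v) :
    MulEquiv.piUnits (M := fun w' : PlacesOver L v => w'.1.adicCompletion L)
        ((localDet (IsCMField.complexConj L) v (isUnit_antidiagOne_det L 2) x : ↥(normOneUnits (conjLocal L (IsCMField.complexConj L) v))) :
          (LocalRing L v)ˣ) w =
      Matrix.GeneralLinearGroup.det (cmSplitEquivTwo L v w hw x) := by
  refine Units.ext ?_
  have hx : ((cmSplitEquivTwo L v w hw x : GL (Fin 2) (w.1.adicCompletion L)) : Matrix (Fin 2) (Fin 2) (w.1.adicCompletion L)) =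
      (((x.1 : GL (Fin 2) (LocalRing L v)) : Matrix (Fin 2) (Fin 2) (LocalRing L v))).map
        (Pi.evalRingHom (fun w' : PlacesOver L v => w'.1.adicCompletion L) w) := rfl
  rw [Matrix.GeneralLinearGroup.val_det_apply, hx, ← RingHom.mapMatrix_apply, ← RingHom.map_det]
  rfl

/-- **`(det h₁)_w = det (e₁ h₁)`** for `h₁ ∈ U(Φ₁)(L⁺_v)`, `e₁ h₁ ∈ GL₁(L_w)`. [cite: Rogawski1990, §4.13 p. 64; §12.2 pp. 173–174] -/
theorem piUnits_localDet_eq_det_cmSplitEquivOne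
    (x : (cmDatum L 1 (Matrix.of fun i j : Fin 1 => if i.val + j.val + 1 = 1 then (1 : L) else 0)).Local v) :
    MulEquiv.piUnits (M := fun w' : PlacesOver L v => w'.1.adicCompletion L)
        ((localDet (IsCMField.complexConj L) v (isUnit_antidiagOne_det L 1) x : ↥(normOneUnits (conjLocal L (IsCMField.complexConj L) v))) :
          (LocalRing L v)ˣ) w =
      Matrix.GeneralLinearGroup.det (cmSplitEquivOne L v w hw x) := by
  refine Units.ext ?_
  have hx : ((cmSplitEquivOne L v w hw x : GL (Fin 1) (w.1.adicCompletion L)) : Matrix (Fin 1) (Fin 1) (w.1.adicCompletion L)) =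
      (((x.1 : GL (Fin 1) (LocalRing L v)) : Matrix (Fin 1) (Fin 1) (LocalRing L v))).map
        (Pi.evalRingHom (fun w' : PlacesOver L v => w'.1.adicCompletion L) w) := rfl
  rw [Matrix.GeneralLinearGroup.val_det_apply, hx, ← RingHom.mapMatrix_apply, ← RingHom.map_det]
  rfl

/-! ## §2 `ξ_v` through `η_w`, `ψ_w` -/

/-- **`ξ_v(h) = η_w(det e₂ h.1) · ψ_w(det e₂ h.1 · det e₁ h.2)`** at a split `v` (`w ∣ v` moved by `c`): the printed `ξ_v(h₀,u) = η_v(det₀ h) ψ_v(det₀ h · u)` (★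
`xiLocalChar_apply_eq`) with each `T(L⁺_v)`-character read on the `w`-factor (★ `torusLocalComponent_eq_inv_localComponent_of_split`: `ξ_v(d) = χ̃_w(d_w)⁻¹`,
and `η_w = (η̃_w)⁻¹`, `ψ_w = (ψ̃_w)⁻¹` by definition, ★ `OneDimAutRepH.locη ∕ locψ`). [cite: Rogawski1990, §13.3 p. 202; §12.2 pp. 173–174] -/
theorem xiLocalChar_eq_locη_mul_locψ_of_split (ξ : OneDimAutRepH L)
    (h : (cmDatum L 2 (Matrix.of fun i j : Fin 2 => if i.val + j.val + 1 = 2 then (1 : L) else 0)).Local v ×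
      (cmDatum L 1 (Matrix.of fun i j : Fin 1 => if i.val + j.val + 1 = 1 then (1 : L) else 0)).Local v) :
    ξ.xiLocalChar v h =
      ξ.locη w.1 (Matrix.GeneralLinearGroup.det (cmSplitEquivTwo L v w hw h.1)) *
        ξ.locψ w.1 (Matrix.GeneralLinearGroup.det (cmSplitEquivTwo L v w hw h.1) * Matrix.GeneralLinearGroup.det (cmSplitEquivOne L v w hw h.2)) := by
  rw [OneDimAutRepH.xiLocalChar_apply_eq,
    torusLocalComponent_eq_inv_localComponent_of_split L (IsCMField.complexConj L) (Algebra.IsQuadraticExtension.finrank_eq_two _ L)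
      (IsCMField.complexConj_ne_one (K := L)) ξ.η ξ.hη w hw,
    torusLocalComponent_eq_inv_localComponent_of_split L (IsCMField.complexConj L) (Algebra.IsQuadraticExtension.finrank_eq_two _ L)
      (IsCMField.complexConj_ne_one (K := L)) ξ.ψ ξ.hψ w hw,
    OneDimAutRepH.locη_apply, OneDimAutRepH.locψ_apply, Subgroup.coe_mul, map_mul, Pi.mul_apply,
    piUnits_localDet_eq_det_cmSplitEquivTwo L v w hw, piUnits_localDet_eq_det_cmSplitEquivOne L v w hw]
  rfl

/-! ## §3 The diagonal blocks of `diag(x₁, x₂)` in the standard Levi -/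

section TwoBlock

variable {S : Type*} [CommRing S] {k l : ℕ}

/-- **The `ff`-block of `reindexGL finSumFinEquiv (diag(x₁, x₂))` has determinant `det x₁`** (any labelling equal to `i ↦ [k ≤ i]`): its `ff`-indices are the
`castAdd l a`, `a : Fin k`, where the entries are those of `x₁` (`Matrix.det_reindex_self`). [cite: Zelevinsky1980, §3.2] [cite: BernsteinZelevinsky1977, §2.1] -/
theorem det_leviProjection_reindexGL_blockDiagGL_false (c : Fin (k + l) → Bool) (hc : c = fun i : Fin (k + l) => decide (k ≤ (i : ℕ)))
    (x : GL (Fin k) S × GL (Fin l) S) (hmem : UnitaryGroup.reindexGL finSumFinEquiv (UnitaryGroup.blockDiagGL x) ∈ standardParabolicGL S c) :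
    Matrix.GeneralLinearGroup.det (leviProjection S c ⟨UnitaryGroup.reindexGL finSumFinEquiv (UnitaryGroup.blockDiagGL x), hmem⟩ false) =
      Matrix.GeneralLinearGroup.det x.1 := by
  subst hc
  -- the `ff`-block is indexed by `Fin k` through `castAdd`
  let e : {i : Fin (k + l) // decide (k ≤ (i : ℕ)) = false} ≃ Fin k :=
    { toFun := fun i => ⟨(i.1 : ℕ), not_le.1 (of_decide_eq_false i.2)⟩
      invFun := fun a => ⟨Fin.castAdd l a, by
        have := twoBlockLabel_finSumFinEquiv_inl k l a
        rwa [finSumFinEquiv_apply_left] at this⟩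
      left_inv := fun i => Subtype.ext (Fin.ext rfl)
      right_inv := fun a => Fin.ext rfl }
  refine Units.ext ?_
  rw [Matrix.GeneralLinearGroup.val_det_apply, Matrix.GeneralLinearGroup.val_det_apply, ← Matrix.det_reindex_self e]
  congr 1
  ext a b
  rw [Matrix.reindex_apply, Matrix.submatrix_apply, leviProjection_apply_coe, Subgroup.coe_mk, UnitaryGroup.coe_reindexGL, Matrix.reindex_apply,
    Matrix.submatrix_apply, UnitaryGroup.coe_blockDiagGL]
  change Matrix.fromBlocks _ 0 0 _ (finSumFinEquiv.symm (Fin.castAdd l a)) (finSumFinEquiv.symm (Fin.castAdd l b)) = _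
  rw [finSumFinEquiv_symm_apply_castAdd, finSumFinEquiv_symm_apply_castAdd, Matrix.fromBlocks_apply₁₁]

/-- **The `tt`-block of `reindexGL finSumFinEquiv (diag(x₁, x₂))` has determinant `det x₂`** (indices `natAdd k b`, `b : Fin l`).
[cite: Zelevinsky1980, §3.2] [cite: BernsteinZelevinsky1977, §2.1] -/
theorem det_leviProjection_reindexGL_blockDiagGL_true (c : Fin (k + l) → Bool) (hc : c = fun i : Fin (k + l) => decide (k ≤ (i : ℕ)))
    (x : GL (Fin k) S × GL (Fin l) S) (hmem : UnitaryGroup.reindexGL finSumFinEquiv (UnitaryGroup.blockDiagGL x) ∈ standardParabolicGL S c) :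
    Matrix.GeneralLinearGroup.det (leviProjection S c ⟨UnitaryGroup.reindexGL finSumFinEquiv (UnitaryGroup.blockDiagGL x), hmem⟩ true) =
      Matrix.GeneralLinearGroup.det x.2 := by
  subst hc
  let e : {i : Fin (k + l) // decide (k ≤ (i : ℕ)) = true} ≃ Fin l :=
    { toFun := fun i => ⟨(i.1 : ℕ) - k, by have h1 := of_decide_eq_true i.2; have h2 := i.1.isLt; omega⟩
      invFun := fun b => ⟨Fin.natAdd k b, by
        have := twoBlockLabel_finSumFinEquiv_inr k l b
        rwa [finSumFinEquiv_apply_right] at this⟩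
      left_inv := fun i => Subtype.ext (Fin.ext (by
        have h1 := of_decide_eq_true i.2
        simp only [Fin.natAdd_mk]
        show k + ((i.1 : ℕ) - k) = (i.1 : ℕ)
        omega))
      right_inv := fun b => Fin.ext (by simp) }
  refine Units.ext ?_
  rw [Matrix.GeneralLinearGroup.val_det_apply, Matrix.GeneralLinearGroup.val_det_apply, ← Matrix.det_reindex_self e]
  congr 1
  ext a b
  rw [Matrix.reindex_apply, Matrix.submatrix_apply, leviProjection_apply_coe, Subgroup.coe_mk, UnitaryGroup.coe_reindexGL, Matrix.reindex_apply,
    Matrix.submatrix_apply, UnitaryGroup.coe_blockDiagGL]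
  change Matrix.fromBlocks _ 0 0 _ (finSumFinEquiv.symm (Fin.natAdd k a)) (finSumFinEquiv.symm (Fin.natAdd k b)) = _
  rw [finSumFinEquiv_symm_apply_natAdd, finSumFinEquiv_symm_apply_natAdd, Matrix.fromBlocks_apply₂₂]

end TwoBlock

/-- **`ff`-block of `cmSplitLeviGL h`**: `det = det (e₂ h.1)` (labelling `Zelevinsky1980.lastBlockLabel 3`, ★ `lastBlockLabel_three_eq`). [cite: Rogawski1990, §4.13 p. 64] -/
theorem det_leviProjection_cmSplitLeviGL_false
    (h : (cmDatum L 2 (Matrix.of fun i j : Fin 2 => if i.val + j.val + 1 = 2 then (1 : L) else 0)).Local v ×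
      (cmDatum L 1 (Matrix.of fun i j : Fin 1 => if i.val + j.val + 1 = 1 then (1 : L) else 0)).Local v)
    (hmem : cmSplitLeviGL L v w hw h ∈ standardParabolicGL (w.1.adicCompletion L) (lastBlockLabel 3)) :
    Matrix.GeneralLinearGroup.det (leviProjection (w.1.adicCompletion L) (lastBlockLabel 3) ⟨cmSplitLeviGL L v w hw h, hmem⟩ false) =
      Matrix.GeneralLinearGroup.det (cmSplitEquivTwo L v w hw h.1) :=
  det_leviProjection_reindexGL_blockDiagGL_false (S := w.1.adicCompletion L) (k := 2) (l := 1) (lastBlockLabel 3) (lastBlockLabel_three_eq)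
    (cmSplitEquivTwo L v w hw h.1, cmSplitEquivOne L v w hw h.2) hmem

/-- **`tt`-block of `cmSplitLeviGL h`**: `det = det (e₁ h.2)`. [cite: Rogawski1990, §4.13 p. 64] -/
theorem det_leviProjection_cmSplitLeviGL_true
    (h : (cmDatum L 2 (Matrix.of fun i j : Fin 2 => if i.val + j.val + 1 = 2 then (1 : L) else 0)).Local v ×
      (cmDatum L 1 (Matrix.of fun i j : Fin 1 => if i.val + j.val + 1 = 1 then (1 : L) else 0)).Local v)
    (hmem : cmSplitLeviGL L v w hw h ∈ standardParabolicGL (w.1.adicCompletion L) (lastBlockLabel 3)) :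
    Matrix.GeneralLinearGroup.det (leviProjection (w.1.adicCompletion L) (lastBlockLabel 3) ⟨cmSplitLeviGL L v w hw h, hmem⟩ true) =
      Matrix.GeneralLinearGroup.det (cmSplitEquivOne L v w hw h.2) :=
  det_leviProjection_reindexGL_blockDiagGL_true (S := w.1.adicCompletion L) (k := 2) (l := 1) (lastBlockLabel 3) (lastBlockLabel_three_eq)
    (cmSplitEquivTwo L v w hw h.1, cmSplitEquivOne L v w hw h.2) hmem

/-! ## §4 The dictionary -/

/-- **THE SPLIT-PLACE ξ-DICTIONARY** [Rogawski1990, Lemma 4.13.1 (b): «let `ρ′ = ρ ⊗ μ_w ∘ det₀` … `Tr(i_G(ρ′)(f)) = Tr(ρ(f^H))`»; §13.3 p. 202]: for `h ∈ H_v`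
at a split `v` (`w ∣ v` moved by `c`),
`ξ_v(h) · μ_w(det (e₂ h.1)) = maxParabolicLeviChar L_w 3 (ν₀) (ψ_w) (blocks of cmSplitLeviGL h)`, `ν₀ = η_w ψ_w μ_w` (★ `OneDimAutRepH.splitν₀`) — the integrand of ★
`UnitaryGroup.integral_mul_cmSplitTransfer` IS the Levi character of ★ `splitMemberGL` on `diag(e₂ h.1, e₁ h.2)`. [cite: Rogawski1990, §4.13 Lemma 4.13.1 (b) p. 64; §13.3 p. 202] -/
theorem xiLocalChar_mul_localComponent_eq_maxParabolicLeviChar (ξ : OneDimAutRepH L) (μ : HeckeCharacter L)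
    (h : (cmDatum L 2 (Matrix.of fun i j : Fin 2 => if i.val + j.val + 1 = 2 then (1 : L) else 0)).Local v ×
      (cmDatum L 1 (Matrix.of fun i j : Fin 1 => if i.val + j.val + 1 = 1 then (1 : L) else 0)).Local v)
    (hmem : cmSplitLeviGL L v w hw h ∈ standardParabolicGL (w.1.adicCompletion L) (lastBlockLabel 3)) :
    ξ.xiLocalChar v h * μ.localComponent w.1 (Matrix.GeneralLinearGroup.det (cmSplitEquivTwo L v w hw h.1)) =
      maxParabolicLeviChar (w.1.adicCompletion L) 3 (ξ.splitν₀ μ w.1) (ξ.locψ w.1)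
        (leviProjection (w.1.adicCompletion L) (lastBlockLabel 3) ⟨cmSplitLeviGL L v w hw h, hmem⟩) := by
  rw [maxParabolicLeviChar_apply, det_leviProjection_cmSplitLeviGL_false L v w hw h hmem, det_leviProjection_cmSplitLeviGL_true L v w hw h hmem,
    OneDimAutRepH.splitν₀_apply, xiLocalChar_eq_locη_mul_locψ_of_split L v w hw ξ h, map_mul]
  -- `η(a) ψ(a) ψ(b) μ(a) = η(a) ψ(a) μ(a) ψ(b)` in the commutative group `ℂˣ`
  generalize ξ.locη w.1 (Matrix.GeneralLinearGroup.det (cmSplitEquivTwo L v w hw h.1)) = p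
  generalize ξ.locψ w.1 (Matrix.GeneralLinearGroup.det (cmSplitEquivTwo L v w hw h.1)) = q
  generalize ξ.locψ w.1 (Matrix.GeneralLinearGroup.det (cmSplitEquivOne L v w hw h.2)) = r
  generalize μ.localComponent w.1 (Matrix.GeneralLinearGroup.det (cmSplitEquivTwo L v w hw h.1)) = s
  rw [mul_assoc p q s, mul_assoc p (q * s) r, mul_assoc q s r, mul_comm s r, ← mul_assoc q r s, ← mul_assoc p (q * r) s]

/-- The same, `ℂ`-valued (the currency of ★ `integral_mul_cmSplitTransfer`). [cite: Rogawski1990, §4.13 Lemma 4.13.1 (b) p. 64] -/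
theorem coe_xiLocalChar_mul_localComponent_eq_maxParabolicLeviChar (ξ : OneDimAutRepH L) (μ : HeckeCharacter L)
    (h : (cmDatum L 2 (Matrix.of fun i j : Fin 2 => if i.val + j.val + 1 = 2 then (1 : L) else 0)).Local v ×
      (cmDatum L 1 (Matrix.of fun i j : Fin 1 => if i.val + j.val + 1 = 1 then (1 : L) else 0)).Local v)
    (hmem : cmSplitLeviGL L v w hw h ∈ standardParabolicGL (w.1.adicCompletion L) (lastBlockLabel 3)) :
    ((ξ.xiLocalChar v h : ℂˣ) : ℂ) * ((μ.localComponent w.1 (Matrix.GeneralLinearGroup.det (cmSplitEquivTwo L v w hw h.1)) : ℂˣ) : ℂ) =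
      ((maxParabolicLeviChar (w.1.adicCompletion L) 3 (ξ.splitν₀ μ w.1) (ξ.locψ w.1)
        (leviProjection (w.1.adicCompletion L) (lastBlockLabel 3) ⟨cmSplitLeviGL L v w hw h, hmem⟩) : ℂˣ) : ℂ) := by
  rw [← Units.val_mul, xiLocalChar_mul_localComponent_eq_maxParabolicLeviChar L v w hw ξ μ h hmem]

end Literature.NumberTheory.Rogawski1990

end
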